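import Summits.FinalStateConjecture.FinalStateConjecture.Theorems.ZeroEnergyKerrOrBombStationaryLimitReductionKerrIsometryRigidityWave3Facts
import Summits.FinalStateConjecture.FinalStateConjecture.Theorems.ZeroEnergyKerrOrBombStationaryLimitReductionTimeEquivariantMaps
import Summits.FinalStateConjecture.FinalStateConjecture.Theorems.ZeroEnergyKerrOrBombStationaryLimitReductionChartReadaptation
import Literature.Geometry.Lorentzian.ADMTransitionRigidity
import Literature.Geometry.Lorentzian.MultiCentreKerrSchild
import Literature.Geometry.Lorentzian.KerrWaveEnergy
import HarnessLib

/-!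
# Route ZeroEnergyKerrOrBomb · crux `FinalStateFromKerrOrBomb` (stmt-FinalStateConjecture-17839), line
# `SketchIdeator1` — stub `stub_kerrAsymptoticRigidity` (F4 of stub 1R), layer 3: the second derivatives
# of the chart identification are controlled by the first derivatives of the two metrics

Helper file (`--supports stmt-FinalStateConjecture-17839`; registered helpers
`kerrAsymptoticRigidity_iteratedFDeriv_two_le`, `kerrAsymptoticRigidity_iteratedFDeriv_two_bounded`) of the
lead's wave-2 stub-worker for `stub_kerrAsymptoticRigidity : SigM.stub_kerrAsymptoticRigidity`
(`:= KerrAsymptoticRigidity`, obligation F4 of stub 1R, `…KerrIsometryRigidityWave3Facts`). The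
hypotheses of F4 are repeated VERBATIM, followed by the conclusion of layer 2
(`kerrAsymptoticRigidity_fderiv_bounded`, p137926: two-sided bounds `‖dΘ_u‖ ≤ L`, `‖v‖ ≤ L ‖dΘ_u v‖` on
`{r ≥ R}`), so that the layers chain.

* §1 the LORENTZIAN CHRISTOFFEL TRICK (`norm_snd_le_of_law_lorentz`): the tree's Riemannian version
  `TransitionRigidity.norm_snd_le_of_law` (`ADMTransitionRigidity.lean`, forms `1/2`-close to `δ`) adapted to
  forms `1/4`-close to `η` — a trilinear `T(u, v, w) = h(S(u, v), P w)` symmetric in `(u, v)` is determined by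
  its symmetrisation in `(v, w)`, and is tested with `P w = 𝒫 S(u, v)`, `𝒫` the time reflection, for which
  `h(p, 𝒫 p) ≥ (3/4)‖p‖²` replaces the Euclidean `h(p, p) ≥ ‖p‖²/2`;
* §2 `kerrAsymptoticRigidity_iteratedFDeriv_two_le`: far out,
  `‖D²Θ(u)‖ ≤ 2L (‖D g_{M,a}(u)‖ + L³ ‖D(A.bilin)(Θ u)‖)` — the differentiated isometry law
  (`TransitionRigidity.fderiv_law_apply`: `D g_{M,a}(u)(z, v, w) = D A.bilin(Θ u)(dΘ z, dΘ v, dΘ w) +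
  A.bilin(Θ u)(D²Θ(z, v), dΘ w) + A.bilin(Θ u)(dΘ v, D²Θ(z, w))`, i.e. `Θ` is affine for the two
  Levi-Civita connections) fed to §1, with `A.bilin` smooth and symmetric on `A.domain`
  (`contDiffOn_adaptedChart_bilin`, `pullbackBilin_symm`) and `1/4`-close to `η` along `Θ` far out;
* §3 `kerrAsymptoticRigidity_iteratedFDeriv_two_bounded`: hence `‖D²Θ‖` is BOUNDED far out, by the decay
  `‖D(g_{M,a} − η)‖ ≤ C/r` (`Kerr.norm_iteratedFDeriv_ksPert_le`) and, on the `A` side, the `C²` clause of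
  `ChartIsAsymptoticallySchwarzschildean'` plus the same decay for `g_{M_A,0}`.

Elementary; no named fact, nothing restated. References: R. Bartnik, CPAM 39 (1986), §3, (3.5)–(3.6) and
Cor. 3.2; P. T. Chruściel, *Boundary conditions at spatial infinity* (1986), §2; P. T. Chruściel,
J. L. Costa, arXiv:0806.0016, §2.1.
-/

set_option linter.dupNamespace false

-- instance search through the nested operator types `E4 →L[ℝ] E4 →L[ℝ] E4 →L[ℝ] ℝ`
set_option maxSynthPendingDepth 3

noncomputable section

open scoped Manifold ContDiff Topology
open Set Filter Function

namespace Summit.FinalStateConjecture.FinalStateConjecture.Theorems.SymplecticDualOfTheBomb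

open Literature.Geometry.Lorentzian
open Summit.FinalStateConjecture.FinalStateConjecture.Theorems.OneLockedExplosion

/-! ## §1 The Lorentzian Christoffel trick -/

section Christoffel

/-- `‖e₀‖ = 1`. [folklore] -/
private theorem norm_basisVector_zero : ‖(E4.basisVector 0 : E4)‖ = 1 := by
  rw [E4.basisVector, PiLp.norm_single, norm_one]

/-- `η(w, w) = ‖w‖² − 2 (w⁰)²` (Euclidean norm of `E4`). [folklore] -/
private theorem minkowski_self_eq (w : E4) : Minkowski.bilin w w = ‖w‖ ^ 2 - 2 * w 0 ^ 2 := by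
  have h : ‖w‖ ^ 2 = w 0 ^ 2 + ∑ i : Fin 3, w i.succ ^ 2 := by
    rw [EuclideanSpace.real_norm_sq_eq, Fin.sum_univ_succ]
  rw [Minkowski.bilin_apply, h]
  have h2 : ∑ i : Fin 3, w i.succ * w i.succ = ∑ i : Fin 3, w i.succ ^ 2 :=
    Finset.sum_congr rfl fun i _ ↦ by ring
  rw [h2]
  ring

/-- `|B(v, w) − η(v, w)| ≤ ‖v‖ ‖w‖ / 4` for `‖B − η‖ ≤ 1/4`. [folklore] -/
private theorem abs_sub_minkowski_le {B : E4 →L[ℝ] E4 →L[ℝ] ℝ} (hB : ‖B - Minkowski.bilin‖ ≤ 1 / 4)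
    (v w : E4) : |B v w - Minkowski.bilin v w| ≤ ‖v‖ * ‖w‖ / 4 := by
  have h := (B - Minkowski.bilin).le_opNorm₂ v w
  rw [Real.norm_eq_abs, sub_apply, sub_apply] at h
  calc |B v w - Minkowski.bilin v w| ≤ ‖B - Minkowski.bilin‖ * ‖v‖ * ‖w‖ := h
    _ ≤ 1 / 4 * ‖v‖ * ‖w‖ := by gcongr
    _ = ‖v‖ * ‖w‖ / 4 := by ring

/-- `(𝒫 p)⁰ = −p⁰` for the time reflection `𝒫 p = p − 2 p⁰ e₀`. [folklore] -/
private theorem timeReflect_apply_zero (p : E4) : (p - (2 * p 0) • E4.basisVector 0) 0 = -p 0 := by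
  simp
  ring

/-- `η(p, 𝒫 p) = ‖p‖²`. [folklore] -/
private theorem minkowski_timeReflect (p : E4) :
    Minkowski.bilin p (p - (2 * p 0) • E4.basisVector 0) = ‖p‖ ^ 2 := by
  rw [map_sub, map_smul, Minkowski.bilin_symm p (E4.basisVector 0),
    Minkowski.bilin_basisVector_zero_left, minkowski_self_eq, smul_eq_mul]
  ring

/-- `‖𝒫 p‖ = ‖p‖` (`𝒫` is an `η`-isometry with `(𝒫 p)⁰ = −p⁰`). [folklore] -/
private theorem norm_timeReflect (p : E4) : ‖p - (2 * p 0) • E4.basisVector 0‖ = ‖p‖ := by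
  have h1 : Minkowski.bilin (p - (2 * p 0) • E4.basisVector 0) (p - (2 * p 0) • E4.basisVector 0) =
      Minkowski.bilin p p := by
    have e : Minkowski.bilin (p - (2 * p 0) • E4.basisVector 0) (p - (2 * p 0) • E4.basisVector 0) =
        Minkowski.bilin p p - (2 * p 0) * Minkowski.bilin (E4.basisVector 0) p -
          (2 * p 0) * (Minkowski.bilin p (E4.basisVector 0) -
            (2 * p 0) * Minkowski.bilin (E4.basisVector 0) (E4.basisVector 0)) := by
      simp only [map_sub, map_smul, sub_apply, FunLike.coe_smul,
        Pi.smul_apply, smul_eq_mul]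
    rw [e, Minkowski.bilin_symm p (E4.basisVector 0), Minkowski.bilin_basisVector_zero_left,
      Minkowski.bilin_basisVector_zero]
    ring
  rw [minkowski_self_eq, minkowski_self_eq, timeReflect_apply_zero, neg_sq] at h1
  have h2 : ‖p - (2 * p 0) • E4.basisVector 0‖ ^ 2 = ‖p‖ ^ 2 := by linarith
  nlinarith [norm_nonneg (p - (2 * p 0) • E4.basisVector 0), norm_nonneg p,
    sq_nonneg (‖p - (2 * p 0) • E4.basisVector 0‖ - ‖p‖), sq_nonneg (‖p - (2 * p 0) • E4.basisVector 0‖ + ‖p‖)]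

/-- **Coercivity by time reflection**: `(3/4)‖p‖² ≤ B(p, 𝒫 p)` for `‖B − η‖ ≤ 1/4`. [folklore] -/
private theorem sq_le_apply_timeReflect {B : E4 →L[ℝ] E4 →L[ℝ] ℝ} (hB : ‖B - Minkowski.bilin‖ ≤ 1 / 4)
    (p : E4) : 3 / 4 * ‖p‖ ^ 2 ≤ B p (p - (2 * p 0) • E4.basisVector 0) := by
  have h := abs_sub_minkowski_le hB p (p - (2 * p 0) • E4.basisVector 0)
  rw [minkowski_timeReflect, norm_timeReflect] at h
  nlinarith [(abs_le.1 h).1]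

/-- A linear map of `E4` with `‖v‖ ≤ L ‖P v‖` is surjective (injective, finite dimension). [folklore] -/
private theorem surjective_of_norm_le {P : E4 →L[ℝ] E4} {L : ℝ} (hPl : ∀ v, ‖v‖ ≤ L * ‖P v‖) :
    Function.Surjective P := by
  have hinj : Function.Injective P := by
    intro v w hvw
    have h := hPl (v - w)
    rw [map_sub, hvw, sub_self, norm_zero, mul_zero] at h
    exact sub_eq_zero.1 (norm_le_zero_iff.1 h)
  exact LinearMap.surjective_of_injective (f := (P : E4 →ₗ[ℝ] E4)) hinj

/-- **The Lorentzian Christoffel trick** (bound on `D²G`). Let `h` be a symmetric form on `E4` with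
`‖h − η‖ ≤ 1/4`, `P` a linear map with `‖P‖ ≤ L` and `‖v‖ ≤ L ‖P v‖`, `S` symmetric bilinear, and suppose the
differentiated transformation law `τ'(u, v, w) = τ(P u, P v, P w) + h(S(u, v), P w) + h(P v, S(u, w))` (in the
application `τ = Dh(G y)`, `τ' = Dh'(y)`, `P = DG(y)`, `S = D²G(y)`). Then `‖S‖ ≤ 2L (‖τ'‖ + L³ ‖τ‖)`:
`T(u, v, w) = h(S(u, v), P w)` is symmetric in `(u, v)` with known symmetrisation in `(v, w)`, so
`2T(u, v, w) = A(u, v, w) + A(v, u, w) − A(w, u, v)`; test with `P w = 𝒫 S(u, v)` (time reflection), for which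
`h(p, 𝒫 p) ≥ (3/4)‖p‖²`. Bartnik 1986, (3.5)–(3.6); Chruściel 1986, §2 (Riemannian case:
`TransitionRigidity.norm_snd_le_of_law`). [folklore] -/
private theorem norm_snd_le_of_law_lorentz {h₀ : E4 →L[ℝ] E4 →L[ℝ] ℝ} {P : E4 →L[ℝ] E4} {L : ℝ}
    (hA : ‖h₀ - Minkowski.bilin‖ ≤ 1 / 4) (hPL : ‖P‖ ≤ L) (hPl : ∀ v, ‖v‖ ≤ L * ‖P v‖)
    (hsym : ∀ a c, h₀ a c = h₀ c a) {S : E4 →L[ℝ] E4 →L[ℝ] E4} (hS : ∀ u v, S u v = S v u)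
    {τ τ' : E4 →L[ℝ] E4 →L[ℝ] E4 →L[ℝ] ℝ}
    (hdlaw : ∀ u v w, τ' u v w = τ (P u) (P v) (P w) + h₀ (S u v) (P w) + h₀ (P v) (S u w)) :
    ‖S‖ ≤ 2 * L * (‖τ'‖ + L ^ 3 * ‖τ‖) := by
  have hL : 0 ≤ L := (norm_nonneg P).trans hPL
  have hPle : ∀ v, ‖P v‖ ≤ L * ‖v‖ := fun v ↦ (P.le_opNorm v).trans (by gcongr)
  set M : ℝ := ‖τ'‖ + L ^ 3 * ‖τ‖ with hM
  have hM0 : 0 ≤ M := by positivity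
  -- the known symmetrisation `A(u,v,w) = T(u,v,w) + T(u,w,v)`
  have hAuvw : ∀ u v w, |h₀ (S u v) (P w) + h₀ (S u w) (P v)| ≤ M * ‖u‖ * ‖v‖ * ‖w‖ := by
    intro u v w
    have heq : h₀ (S u v) (P w) + h₀ (S u w) (P v) = τ' u v w - τ (P u) (P v) (P w) := by
      rw [hdlaw u v w, hsym (P v) (S u w)]
      ring
    rw [heq]
    have h1 : |τ' u v w| ≤ ‖τ'‖ * ‖u‖ * ‖v‖ * ‖w‖ := by
      rw [← Real.norm_eq_abs]
      calc ‖τ' u v w‖ ≤ ‖τ' u v‖ * ‖w‖ := ContinuousLinearMap.le_opNorm _ _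
        _ ≤ ‖τ' u‖ * ‖v‖ * ‖w‖ := by gcongr; exact ContinuousLinearMap.le_opNorm _ _
        _ ≤ ‖τ'‖ * ‖u‖ * ‖v‖ * ‖w‖ := by gcongr; exact ContinuousLinearMap.le_opNorm _ _
    have h2 : |τ (P u) (P v) (P w)| ≤ ‖τ‖ * (L * ‖u‖) * (L * ‖v‖) * (L * ‖w‖) := by
      rw [← Real.norm_eq_abs]
      calc ‖τ (P u) (P v) (P w)‖ ≤ ‖τ (P u) (P v)‖ * ‖P w‖ := ContinuousLinearMap.le_opNorm _ _
        _ ≤ ‖τ (P u)‖ * ‖P v‖ * ‖P w‖ := by gcongr; exact ContinuousLinearMap.le_opNorm _ _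
        _ ≤ ‖τ‖ * ‖P u‖ * ‖P v‖ * ‖P w‖ := by gcongr; exact ContinuousLinearMap.le_opNorm _ _
        _ ≤ ‖τ‖ * (L * ‖u‖) * (L * ‖v‖) * (L * ‖w‖) := by gcongr <;> exact hPle _
    calc |τ' u v w - τ (P u) (P v) (P w)| ≤ |τ' u v w| + |τ (P u) (P v) (P w)| := abs_sub _ _
      _ ≤ ‖τ'‖ * ‖u‖ * ‖v‖ * ‖w‖ + ‖τ‖ * (L * ‖u‖) * (L * ‖v‖) * (L * ‖w‖) := add_le_add h1 h2
      _ = M * ‖u‖ * ‖v‖ * ‖w‖ := by rw [hM]; ring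
  -- hence `T` itself is bounded
  have hT : ∀ u v w, |h₀ (S u v) (P w)| ≤ 3 / 2 * M * ‖u‖ * ‖v‖ * ‖w‖ := by
    intro u v w
    have e1 := hAuvw u v w
    have e2 := hAuvw v u w
    have e3 := hAuvw w u v
    rw [hS v u] at e2
    rw [hS w u, hS w v] at e3
    have key : 2 * h₀ (S u v) (P w) = (h₀ (S u v) (P w) + h₀ (S u w) (P v)) +
        (h₀ (S u v) (P w) + h₀ (S v w) (P u)) - (h₀ (S u w) (P v) + h₀ (S v w) (P u)) := by ring
    have : |2 * h₀ (S u v) (P w)| ≤ 3 * (M * ‖u‖ * ‖v‖ * ‖w‖) := by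
      rw [key]
      calc _ ≤ |h₀ (S u v) (P w) + h₀ (S u w) (P v) + (h₀ (S u v) (P w) + h₀ (S v w) (P u))| +
            |h₀ (S u w) (P v) + h₀ (S v w) (P u)| := abs_sub _ _
        _ ≤ (|h₀ (S u v) (P w) + h₀ (S u w) (P v)| + |h₀ (S u v) (P w) + h₀ (S v w) (P u)|) +
            |h₀ (S u w) (P v) + h₀ (S v w) (P u)| := by gcongr; exact abs_add_le _ _
        _ ≤ (M * ‖u‖ * ‖v‖ * ‖w‖ + M * ‖v‖ * ‖u‖ * ‖w‖) + M * ‖w‖ * ‖u‖ * ‖v‖ :=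
            add_le_add (add_le_add e1 e2) e3
        _ = 3 * (M * ‖u‖ * ‖v‖ * ‖w‖) := by ring
    rw [abs_mul, abs_two] at this
    linarith
  -- test with `P w = 𝒫 S(u, v)`
  refine ContinuousLinearMap.opNorm_le_bound₂ _ (by positivity) fun u v ↦ ?_
  obtain ⟨w, hw⟩ := surjective_of_norm_le hPl (S u v - (2 * S u v 0) • E4.basisVector 0)
  have hwn : ‖w‖ ≤ L * ‖S u v‖ := by
    have := hPl w
    rwa [hw, norm_timeReflect] at this
  have h1 : 3 / 4 * ‖S u v‖ ^ 2 ≤ h₀ (S u v) (S u v - (2 * S u v 0) • E4.basisVector 0) :=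
    sq_le_apply_timeReflect hA _
  have h2 : h₀ (S u v) (S u v - (2 * S u v 0) • E4.basisVector 0) ≤ 3 / 2 * M * ‖u‖ * ‖v‖ * ‖w‖ := by
    have := hT u v w
    rw [hw] at this
    exact (le_abs_self _).trans this
  have h3 : ‖S u v‖ ^ 2 ≤ (2 * L * M * ‖u‖ * ‖v‖) * ‖S u v‖ := by
    have : 3 / 2 * M * ‖u‖ * ‖v‖ * ‖w‖ ≤ 3 / 2 * M * ‖u‖ * ‖v‖ * (L * ‖S u v‖) := by gcongr
    nlinarith
  by_cases h0 : ‖S u v‖ = 0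
  · rw [h0]; positivity
  · have hpos : 0 < ‖S u v‖ := lt_of_le_of_ne (norm_nonneg _) (Ne.symm h0)
    calc ‖S u v‖ = ‖S u v‖ ^ 2 / ‖S u v‖ := by rw [sq, mul_div_cancel_right₀ _ h0]
      _ ≤ (2 * L * M * ‖u‖ * ‖v‖) * ‖S u v‖ / ‖S u v‖ := by gcongr
      _ = 2 * L * M * ‖u‖ * ‖v‖ := mul_div_cancel_right₀ _ h0
      _ = 2 * L * (‖τ'‖ + L ^ 3 * ‖τ‖) * ‖u‖ * ‖v‖ := by rw [hM]

end Christoffel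

/-! ## §2 `D²Θ` against the first derivatives of the two metrics -/

section SecondDerivative

variable {𝓑 : StationaryAFBlackHole.{0}}

/-- The components of an adapted chart are symmetric on its domain (`A.bilin = φ^* g` there). [folklore] -/
private theorem adaptedChart_bilin_symm (A : 𝓑.AdaptedChart) {u : E4} (hu : u ∈ A.domain) (v w : E4) :
    A.bilin u v w = A.bilin u w v := by
  rw [A.bilin_eq ⟨u, hu⟩]
  exact pullbackBilin_symm (I := 𝓡 4) (I' := 𝓘(ℝ, E4)) A.toFun 𝓑.metric.val
    (fun x v w ↦ 𝓑.metric.symm x v w) ⟨u, hu⟩ v w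

/-- `‖D²f(x)‖ = ‖D(Df)(x)‖` (curried iterated derivative). [folklore] -/
private theorem norm_iteratedFDeriv_two (f : E4 → E4) (x : E4) :
    ‖iteratedFDeriv ℝ 2 f x‖ = ‖fderiv ℝ (fderiv ℝ f) x‖ :=
  calc ‖iteratedFDeriv ℝ 2 f x‖ = ‖iteratedFDeriv ℝ 1 (fderiv ℝ f) x‖ := norm_iteratedFDeriv_fderiv.symm
    _ = ‖iteratedFDeriv ℝ 0 (fderiv ℝ (fderiv ℝ f)) x‖ := norm_iteratedFDeriv_fderiv.symm
    _ = ‖fderiv ℝ (fderiv ℝ f) x‖ := norm_iteratedFDeriv_zero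

end SecondDerivative

/-- **Registered helper `kerrAsymptoticRigidity_iteratedFDeriv_two_le`** (layer 3 of F4 = `KerrAsymptoticRigidity`; its binder
list verbatim, followed by the conclusion of layer 2 `kerrAsymptoticRigidity_fderiv_bounded` as a hypothesis): if on
`{r ≥ R}` the differential of `Θ` obeys `‖dΘ_u‖ ≤ L` and `‖v‖ ≤ L ‖dΘ_u v‖`, then far out
`‖D²Θ(u)‖ ≤ 2L (‖D g_{M,a}(u)‖ + L³ ‖D(A.bilin)(Θ u)‖)`. Proof: `Θ` is an isometry from `g_{M,a}` to `A.bilin`,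
so differentiating the transformation law (`TransitionRigidity.fderiv_law_apply`; `A.bilin` is `C^∞` on the open
`A.domain`, `contDiffOn_adaptedChart_bilin`, and `g_{M,a}` on the exterior) gives
`D g_{M,a}(u)(z, v, w) = D A.bilin(Θ u)(dΘ z, dΘ v, dΘ w) + A.bilin(Θ u)(D²Θ(z, v), dΘ w) + A.bilin(Θ u)(dΘ v, D²Θ(z, w))`
with `D²Θ(u)` symmetric (`ContDiffAt.isSymmSndFDerivAt`) and `A.bilin (Θ u)` symmetric and `1/4`-close to `η` far
out (clause (1) of `ChartIsAsymptoticallyCartesian`, end matching); the Lorentzian Christoffel trick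
`norm_snd_le_of_law_lorentz` concludes. Bartnik 1986, §3, (3.5)–(3.6); Chruściel 1986, §2. [folklore] -/
theorem kerrAsymptoticRigidity_iteratedFDeriv_two_le : ∀ (𝓑 : StationaryAFBlackHole.{0}) (A : 𝓑.AdaptedChart) (M a c : ℝ) (Θ : E4 → E4), ChartIsAsymptoticallyCartesian A → ChartIsAsymptoticallySchwarzschildean' A → Kerr.IsSubextremal M a → 0 < c → ContDiffOn ℝ ∞ Θ (Kerr.exterior M a : Set E4) → Set.InjOn Θ (Kerr.exterior M a : Set E4) → Set.MapsTo Θ (Kerr.exterior M a : Set E4) (A.domain : Set E4) → (∀ x ∈ (Kerr.exterior M a : Set E4), ∀ s : ℝ, Θ (x + s • E4.basisVector 0) = Θ x + (c * s) • E4.basisVector 0) → (∀ x ∈ (Kerr.exterior M a : Set E4), ∀ v w : E4, A.bilin (Θ x) (fderiv ℝ Θ x v) (fderiv ℝ Θ x w) = Kerr.bilin M a x v w) → Θ '' (Kerr.exterior M a : Set E4) = {u : E4 | ∃ h : u ∈ A.domain, A.toFun ⟨u, h⟩ ∈ 𝓑.doc} → (∀ R₁ : ℝ, ∃ R : ℝ,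 ∀ x ∈ (Kerr.exterior M a : Set E4), R ≤ Kerr.radius a x → R₁ ≤ A.radius (Θ x)) → ∀ R L : ℝ, (∀ u ∈ (Kerr.exterior M a : Set E4), R ≤ Kerr.radius a u → ‖fderiv ℝ Θ u‖ ≤ L ∧ ∀ v : E4, ‖v‖ ≤ L * ‖fderiv ℝ Θ u v‖) → ∃ R' : ℝ, ∀ u ∈ (Kerr.exterior M a : Set E4), R' ≤ Kerr.radius a u → ‖iteratedFDeriv ℝ 2 Θ u‖ ≤ 2 * L * (‖fderiv ℝ (Kerr.bilin M a) u‖ + L ^ 3 * ‖fderiv ℝ A.bilin (Θ u)‖) := by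
  intro 𝓑 A M a c Θ hcart _ _ _ hΘs _ hΘmaps _ hΘiso _ hfar R L hRL
  have hSo : IsOpen (Kerr.exterior M a : Set E4) := (Kerr.exterior M a).isOpen
  obtain ⟨R₀, hR₀⟩ := hcart.1 (1 / 4) (by norm_num)
  obtain ⟨R₁, hR₁⟩ := hfar R₀
  refine ⟨max R R₁, fun u hu huR ↦ ?_⟩
  obtain ⟨hPL, hPl⟩ := hRL u hu ((le_max_left _ _).trans huR)
  have hdom : Θ u ∈ A.domain := hΘmaps hu
  have hAu : ‖A.bilin (Θ u) - Minkowski.bilin‖ ≤ 1 / 4 :=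
    hR₀ ⟨Θ u, hdom⟩ (hR₁ u hu ((le_max_right _ _).trans huR))
  have hxn : (Kerr.exterior M a : Set E4) ∈ 𝓝 u := hSo.mem_nhds hu
  have hΘu : ContDiffAt ℝ ∞ Θ u := hΘs.contDiffAt hxn
  -- the differentiated transformation law
  have hlaw : ∀ᶠ z in 𝓝 u, ∀ v w, Kerr.bilin M a z v w = A.bilin (Θ z) (fderiv ℝ Θ z v) (fderiv ℝ Θ z w) :=
    Filter.eventually_of_mem hxn fun z hz v w ↦ (hΘiso z hz v w).symm
  have hh : DifferentiableAt ℝ A.bilin (Θ u) :=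
    ((contDiffOn_adaptedChart_bilin A).contDiffAt (A.domain.isOpen.mem_nhds hdom)).differentiableAt
      (by simp)
  have hh' : DifferentiableAt ℝ (Kerr.bilin M a) u := Kerr.differentiableAt_bilin M a ⟨u, hu⟩
  have hΘ2 : ContDiffAt ℝ 2 Θ u := hΘu.of_le (WithTop.coe_le_coe.mpr le_top)
  have hdlaw := fun z v w ↦ TransitionRigidity.fderiv_law_apply hlaw hΘ2 hh hh' z v w
  -- symmetries
  have hS : ∀ v w, fderiv ℝ (fderiv ℝ Θ) u v w = fderiv ℝ (fderiv ℝ Θ) u w v :=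
    fun v w ↦ hΘu.isSymmSndFDerivAt
      (by simp only [minSmoothness_of_isRCLikeNormedField]; exact WithTop.coe_le_coe.mpr le_top) v w
  have hsym : ∀ p q, A.bilin (Θ u) p q = A.bilin (Θ u) q p := fun p q ↦
    adaptedChart_bilin_symm A hdom p q
  rw [norm_iteratedFDeriv_two]
  exact norm_snd_le_of_law_lorentz hAu hPL hPl hsym hS hdlaw

/-! ## §3 `D²Θ` is bounded far out -/

/-- `‖D¹(f − c)(x)‖ = ‖Df(x)‖` (norms of `iteratedFDeriv 1` and `fderiv`; constants drop out). [folklore] -/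
private theorem norm_iteratedFDeriv_one_sub_const (f : E4 → E4 →L[ℝ] E4 →L[ℝ] ℝ)
    (c : E4 →L[ℝ] E4 →L[ℝ] ℝ) (x : E4) : ‖iteratedFDeriv ℝ 1 (fun y ↦ f y - c) x‖ = ‖fderiv ℝ f x‖ :=
  calc ‖iteratedFDeriv ℝ 1 (fun y ↦ f y - c) x‖ = ‖iteratedFDeriv ℝ 0 (fderiv ℝ (fun y ↦ f y - c)) x‖ :=
      norm_iteratedFDeriv_fderiv.symm
    _ = ‖fderiv ℝ (fun y ↦ f y - c) x‖ := norm_iteratedFDeriv_zero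
    _ = ‖fderiv ℝ f x‖ := by rw [fderiv_sub_const]

/-- `‖D¹f(x)‖ = ‖Df(x)‖`. [folklore] -/
private theorem norm_iteratedFDeriv_one (f : E4 → E4 →L[ℝ] E4 →L[ℝ] ℝ) (x : E4) :
    ‖iteratedFDeriv ℝ 1 f x‖ = ‖fderiv ℝ f x‖ :=
  calc ‖iteratedFDeriv ℝ 1 f x‖ = ‖iteratedFDeriv ℝ 0 (fderiv ℝ f) x‖ := norm_iteratedFDeriv_fderiv.symm
    _ = ‖fderiv ℝ f x‖ := norm_iteratedFDeriv_zero

/-- **The first derivatives of the chart components are bounded far out**: in an asymptotically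
Schwarzschildean (`C²`) adapted chart, `‖D(A.bilin)(y)‖ ≤ B` for `y ∈ A.domain` with `A.radius y ≥ R₂`
(`D(A.bilin − g_{M_A,0}) = O(r_A⁻³)` by the `C²` clause, `D g_{M_A,0} = O(1/‖y_{space}‖)` by
`Kerr.norm_iteratedFDeriv_ksPert_le`, and `|A.radius − ‖·_{space}‖| ≤ C_A`). [folklore] -/
private theorem exists_norm_fderiv_adaptedChart_bilin_le {𝓑 : StationaryAFBlackHole.{0}} (A : 𝓑.AdaptedChart)
    (hschw : ChartIsAsymptoticallySchwarzschildean' A) :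
    ∃ R₂ B : ℝ, ∀ y ∈ (A.domain : Set E4), R₂ ≤ A.radius y → ‖fderiv ℝ A.bilin y‖ ≤ B := by
  obtain ⟨MA, CA, RA, -, hder⟩ := hschw
  obtain ⟨C₀, R₀, hR₀, hK₀⟩ := Kerr.norm_iteratedFDeriv_ksPert_le MA 0 1
  obtain ⟨D, hD⟩ := A.exists_abs_radius_sub_spatialNorm_le
  refine ⟨max (max RA 1) (R₀ + D), |CA| + |C₀| / R₀, fun y hy hyR ↦ ?_⟩
  have hRA : RA ≤ A.radius y := ((le_max_left _ _).trans (le_max_left _ _)).trans hyR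
  have h1 : 1 ≤ A.radius y := ((le_max_right _ _).trans (le_max_left _ _)).trans hyR
  have hsp : R₀ ≤ Kerr.radius 0 y := by
    rw [Kerr.radius_zero_left]
    have := hD y
    have h' : R₀ + D ≤ A.radius y := (le_max_right _ _).trans hyR
    linarith [(abs_le.1 this).2]
  have hr0 : 0 < Kerr.radius 0 y := hR₀.trans_le hsp
  -- the two pieces
  have hdA : DifferentiableAt ℝ A.bilin y :=
    ((contDiffOn_adaptedChart_bilin A).contDiffAt (A.domain.isOpen.mem_nhds hy)).differentiableAt (by simp)
  have hdK : DifferentiableAt ℝ (Kerr.bilin MA 0) y :=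
    (Kerr.contDiffAt_bilin MA 0 hr0 (n := 1)).differentiableAt one_ne_zero
  have hpert := hder ⟨y, hy⟩ hRA 1 (by norm_num)
  rw [norm_iteratedFDeriv_one] at hpert
  have hK := hK₀ y hsp
  rw [norm_iteratedFDeriv_one_sub_const] at hK
  have e : fderiv ℝ A.bilin y = fderiv ℝ (fun z ↦ A.bilin z - Kerr.bilin MA 0 z) y + fderiv ℝ (Kerr.bilin MA 0) y := by
    rw [fderiv_fun_sub hdA hdK, sub_add_cancel]
  rw [e]
  refine (norm_add_le _ _).trans (add_le_add ?_ ?_)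
  · refine hpert.trans ?_
    simp only [Nat.reduceAdd]
    calc CA / A.radius y ^ 3 ≤ |CA| / A.radius y ^ 3 := by gcongr; exact le_abs_self _
      _ ≤ |CA| / 1 := div_le_div_of_nonneg_left (abs_nonneg _) one_pos (one_le_pow₀ h1)
      _ = |CA| := div_one _
  · refine hK.trans ?_
    calc C₀ / Kerr.radius 0 y ≤ |C₀| / Kerr.radius 0 y := by gcongr; exact le_abs_self _
      _ ≤ |C₀| / R₀ := div_le_div_of_nonneg_left (abs_nonneg _) hR₀ hsp

/-- **Registered helper `kerrAsymptoticRigidity_iteratedFDeriv_two_bounded`** (layer 3 of F4, bounded form; binder list of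
`KerrAsymptoticRigidity` verbatim followed by the conclusion of layer 2): if on `{r ≥ R}` the differential of `Θ` obeys
`‖dΘ_u‖ ≤ L`, `‖v‖ ≤ L ‖dΘ_u v‖`, then `‖D²Θ‖` is bounded on some `{r ≥ R'}`. From
`kerrAsymptoticRigidity_iteratedFDeriv_two_le` and the boundedness far out of `D g_{M,a}`
(`‖D(g_{M,a} − η)‖ ≤ C/r`, `Kerr.norm_iteratedFDeriv_ksPert_le`) and of `D(A.bilin)` along `Θ`
(`exists_norm_fderiv_adaptedChart_bilin_le` at `A`-radius `→ ∞`, end matching). Bartnik 1986, §3, Cor. 3.2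
(`∂²y/∂x∂x` bounded); Chruściel–Costa arXiv:0806.0016, §2.1. [folklore] -/
theorem kerrAsymptoticRigidity_iteratedFDeriv_two_bounded : ∀ (𝓑 : StationaryAFBlackHole.{0}) (A : 𝓑.AdaptedChart) (M a c : ℝ) (Θ : E4 → E4), ChartIsAsymptoticallyCartesian A → ChartIsAsymptoticallySchwarzschildean' A → Kerr.IsSubextremal M a → 0 < c → ContDiffOn ℝ ∞ Θ (Kerr.exterior M a : Set E4) → Set.InjOn Θ (Kerr.exterior M a : Set E4) → Set.MapsTo Θ (Kerr.exterior M a : Set E4) (A.domain : Set E4) → (∀ x ∈ (Kerr.exterior M a : Set E4), ∀ s : ℝ, Θ (x + s • E4.basisVector 0) = Θ x + (c * s) • E4.basisVector 0) → (∀ x ∈ (Kerr.exterior M a : Set E4), ∀ v w : E4, A.bilin (Θ x) (fderiv ℝ Θ x v) (fderiv ℝ Θ x w) = Kerr.bilin M a x v w) → Θ '' (Kerr.exterior M a : Set E4) = {u : E4 | ∃ h : u ∈ A.domain, A.toFun ⟨u, h⟩ ∈ 𝓑.doc} → (∀ R₁ : ℝ, ∃ R : ℝ, ∀ x ∈ (Kerr.exterior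 M a : Set E4), R ≤ Kerr.radius a x → R₁ ≤ A.radius (Θ x)) → ∀ R L : ℝ, (∀ u ∈ (Kerr.exterior M a : Set E4), R ≤ Kerr.radius a u → ‖fderiv ℝ Θ u‖ ≤ L ∧ ∀ v : E4, ‖v‖ ≤ L * ‖fderiv ℝ Θ u v‖) → ∃ R' L₂ : ℝ, ∀ u ∈ (Kerr.exterior M a : Set E4), R' ≤ Kerr.radius a u → ‖iteratedFDeriv ℝ 2 Θ u‖ ≤ L₂ := by
  intro 𝓑 A M a c Θ hcart hschw hMa hc hΘs hΘinj hΘmaps hΘT hΘiso hΘimg hfar R L hRL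
  obtain ⟨R', hR'⟩ := kerrAsymptoticRigidity_iteratedFDeriv_two_le 𝓑 A M a c Θ hcart hschw hMa hc hΘs hΘinj
    hΘmaps hΘT hΘiso hΘimg hfar R L hRL
  obtain ⟨CK, RK, hRK, hK⟩ := Kerr.norm_iteratedFDeriv_ksPert_le M a 1
  obtain ⟨R₂, B, hB⟩ := exists_norm_fderiv_adaptedChart_bilin_le A hschw
  obtain ⟨R₃, hR₃⟩ := hfar R₂
  have hL : 0 ≤ L := by
    obtain ⟨x, hx, hxR⟩ : ∃ x ∈ (Kerr.exterior M a : Set E4), max R R' ≤ Kerr.radius a x := by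
      -- a far point of the exterior: `(0, (K + |a|) e₁)`
      set K : ℝ := max (max R R') (max (Kerr.rPlus M a) 0 + 1) with hK
      have hK0 : 0 ≤ K := le_max_of_le_right (by positivity)
      set y : E3 := EuclideanSpace.single 0 (K + |a|) with hy
      have hyn : ‖y‖ = K + |a| := by
        rw [hy, PiLp.norm_single, Real.norm_eq_abs, abs_of_nonneg (by positivity)]
      have h1 := Kerr.spatialNorm_sq_sub_sq_le_radius_sq a (E4.ofTimeSpace 0 y)
      rw [E4.spatialNorm_ofTimeSpace, hyn] at h1
      have h2 : K ^ 2 ≤ Kerr.radius a (E4.ofTimeSpace 0 y) ^ 2 := by nlinarith [abs_nonneg a, sq_abs a]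
      have h3 : K ≤ Kerr.radius a (E4.ofTimeSpace 0 y) :=
        (pow_le_pow_iff_left₀ hK0 (Kerr.radius_nonneg _ _) two_ne_zero).1 h2
      refine ⟨E4.ofTimeSpace 0 y, ?_, (le_max_left _ _).trans h3⟩
      rw [SetLike.mem_coe, Kerr.mem_exterior]
      have : max (Kerr.rPlus M a) 0 + 1 ≤ K := le_max_right _ _
      linarith
    exact (norm_nonneg _).trans (hRL x hx ((le_max_left _ _).trans hxR)).1
  refine ⟨max (max R' RK) (max R₃ 1), 2 * L * (|CK| + L ^ 3 * B), fun u hu huR ↦ ?_⟩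
  have h1 := hR' u hu (((le_max_left _ _).trans (le_max_left _ _)).trans huR)
  have hr1 : 1 ≤ Kerr.radius a u := ((le_max_right _ _).trans (le_max_right _ _)).trans huR
  have hKu : ‖fderiv ℝ (Kerr.bilin M a) u‖ ≤ |CK| := by
    have h := hK u (((le_max_right _ _).trans (le_max_left _ _)).trans huR)
    rw [norm_iteratedFDeriv_one_sub_const] at h
    refine h.trans ?_
    calc CK / Kerr.radius a u ≤ |CK| / Kerr.radius a u := by gcongr; exact le_abs_self _
      _ ≤ |CK| := div_le_self (abs_nonneg _) hr1
  have hAu : ‖fderiv ℝ A.bilin (Θ u)‖ ≤ B :=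
    hB (Θ u) (hΘmaps hu) (hR₃ u hu (((le_max_left _ _).trans (le_max_right _ _)).trans huR))
  refine h1.trans ?_
  have hL3 : 0 ≤ L ^ 3 := by positivity
  gcongr

end Summit.FinalStateConjecture.FinalStateConjecture.Theorems.SymplecticDualOfTheBomb

end
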